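import Summits.HodgeConjecture.HodgeConjecture.Theorems.R90S1BposRamShellFibresOdd     -- ★ (6b) PART 1 FILE 2 p864416 (⇒ ★ FILE 1 p864337): scaling, even fibres vanish, odd fibres → level-one sphere
import Summits.HodgeConjecture.HodgeConjecture.Theorems.R90S1BposRamShellMeasurability  -- ★ (6b) PART 2 (A) p864304 (R90-C10-p08): `measurableSet_setOf_valued_add_eq_exp` (translated spheres are Borel)
import HarnessLib

/-!
# R90 · S1 ∕ U4Keys leaf (U4f-χ₁-ram-one-pos), BRANCH B AT A TAME RAMIFIED PLACE — brick (B-10)(6e): THE FIBRE ROWS OF THE CUT-OFF SHELLS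
# `∫_{|a(x)+y|_w = eʲ} F₀(a(x)+y) dμ⁻ ∈ {0, X^{κ+1} q^{−κ} Φdeep, X^{κ+1} q^{−κ} Φcrit}` for `a(x) = −(x·σx)·c`, by `|x|²` against `e^{j−N}`, `e^{j−N+1}` (`N = m+1`)
# [Keys1984 §4–§5, §7 Thm (2) (d); Rogawski1990 §1.10, §12.2 (2); WeilBNT1967 Ch. II §5]

Cell `pub/hodgecm-mathlib` (D-0151), SLAB R90-TF, section S1, crux H413 = `stmt-HodgeConjecture-24833` (lane `--supports … --as helper`), route of record `HCCMUnconditional`; prover seat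
`hodgecm-mathlib-R90-C10-p07` (g2); dealer ruling R-S1-27 (L2): the layer between the PRODUCERS (★ (6b) PART 1 FILES 1–2 = the fibres; (6a) = the values of the level-one sphere integral
`Φ`) and ★ (6b) PART 2 (B) `R90S1BposRamCutoffShells.exists_haarScalar_setIntegral_shell_cutoff`, whose hypotheses `hfib_hi ∕ hfib_mid ∕ hfib_lo` §3 discharges IN (B)'s BINDER SHAPES with
explicit `A j`, `B j`.  THEOREMS ONLY (no `def` ∕ `instance` ∕ notation ∕ named-fact hypothesis ∕ `sorry`); ★-only imports.  NOT THE PAYER of :182.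
FRAME (= ★ (6b) PART 1): `R := LocalRing L v` at a NON-SPLIT place (`w`, `hw`), TAME RAMIFIED (`he`, `h2w`); `σ := conjLocal L c v`, `R⁻ := HeisRing.skewPart σ`, `μ⁻ = μY` regular additive
Haar on `R⁻`; `F₀(z) := χ₁((σẑ)⁻¹)·‖ẑ‖_R⁻¹` ((B)'s inline `dite`, BYTE FOR BYTE); `Ē(r) := χ₁(r̂)⁻¹` ((5a)∕(6a)'s inline `dite`); POSITIVE DEPTH in the C-pack letters `(χ₁ h₁ hfixP) {ϖ} (hϖ)
{m} (hm : 1 ≤ m) (u₁ hu₁ hχu₁)` (`N = m+1`, J3 done inside); SCALING LETTERS `(l : Rˣ) (hlσ hlv hlm)` (ONE CURRENCY: ★ PART 1 §0 at `l := Units.map σ piU * piU`, `X := χ₁ l`); BASE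
LETTERS `{c : R} (hcσ : σc = c) (hcw : |c_w| = 1)` (both hold at `c = ⅟2`), `a(x) := −(x·σx)·c`; `q := ((Ideal.absNorm v.asIdeal : ℝ) : ℂ)` (PART 1 currency, `N𝔓_w = N𝔭_v` here).
THE SPHERE VALUES ARE LETTERS (p08 (g2) interface note — ONE file serves (R-a) and (R-b)): `Φ(a′) := ∫_{s ∈ R⁻ : |s_w| = exp(−1)} Ē(a′ − s) dμ⁻` ((6a)'s LHS bytes) on the BASE FAMILY
`a′ = lᵗ·a(x)` keyed by LEVEL: `hΦdeep : |a′_w| ≤ |ϖ|^(m+2) → Φ(a′) = Φdeep`, `hΦcrit : |a′_w| = |ϖ|^(m+1) → Φ(a′) = Φcrit`, `hΦsh : |ϖ|^(m+1) < |a′_w| ≤ |ϖ|^2 → Φ(a′) = 0` ((R-b): (G3),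
(G2), (G4), constancy along the family by (G1) + hB — `a′₁∕a′₂` is a NORM; (R-a): `Φdeep = Ē(−δ)ν(C)`, `Φcrit = −Ē(−δ)ν(𝔪⁺)`).
* §0 letters (`|ϖ|^n = exp(−n)`, J3, the level of the scaled base vs `|x_w|²`); §1 **ON THE LEVEL-ONE SPHERE `F₀(a′ + s) = q·Ē(a′ − s)`** for `σ`-fixed `a′`, `|a′_w| ≤ exp(−2)`, hence
  `∫_{sphere} F₀(a′ + s) dμ⁻ = q·Φ(a′)`; §2 THE κ-ROWS: `j = 2κ` ⇒ `0` (★ PART 1 §3); `j = 2κ+1`: `|x|² ≤ e^{j−N}` ⇒ `X^{κ+1} q^{−κ} Φdeep`, `= e^{j−N+1}` ⇒ `X^{κ+1} q^{−κ} Φcrit`,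
  `> e^{j−N+1}` ⇒ `0` (shallow letter below `|x|² < eʲ`, empty fibre above, parity excludes equality); §3 **THE THREE ROWS IN (B)'s BINDER SHAPES** at `N := m + 1` with
  `A j := if Even j then 0 else X^(j∕2+1)·(q⁻¹)^(j∕2)·Φdeep`, `B j := if Even j then 0 else X^(j∕2+1)·(q⁻¹)^(j∕2)·Φcrit` — (6d) passes them VERBATIM into ★ (B).
HONEST LABEL.  HC_CM is proved only modulo the 7 printed citations (2 remaining named inputs: hLiu418 = `stmt-HodgeConjecture-24832`, h413 = `stmt-HodgeConjecture-24833`) until rung 0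
closes; count-neutral — this file does NOT pay :182 (nor :155, nor A2′); no printed citation is discharged; REL ≠ ★ ≠ BUILT.

## References
* [Keys1984] D. Keys, *Principal series representations of special unitary groups over local fields*, Compositio Math. 51 (1984), §4–§5, §7 Theorem (2) (d) p. 126.
* [Rogawski1990] J. D. Rogawski, *Automorphic Representations of Unitary Groups in Three Variables*, Ann. of Math. Stud. 123 (1990), §1.10 p. 9, §12.2 (2) p. 173.
* [WeilBNT1967] A. Weil, *Basic Number Theory* (1967), Ch. I §2, Ch. II §5.
-/

set_option autoImplicit false
-- the mandated namespace has the single-problem summit's repeated segment (`HodgeConjecture.HodgeConjecture`)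
set_option linter.dupNamespace false

noncomputable section
open NumberField IsDedekindDomain MeasureTheory Measure Topology Set
open scoped NNReal ENNReal
open Literature.NumberTheory Literature.NumberTheory.Automorphic Literature.NumberTheory.Automorphic.UnitaryGroup

namespace Summit.HodgeConjecture.HodgeConjecture.R90.S1.BposRamFibreRows

open Summit.HodgeConjecture.HodgeConjecture.Cruxes.H413
open Summit.HodgeConjecture.HodgeConjecture.R90.S1
open Summit.HodgeConjecture.HodgeConjecture.R90.S1.BposRamShellFibres
open Summit.HodgeConjecture.HodgeConjecture.R90.S1.BposRamShellFibresOdd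
open Literature.NumberTheory.LocalFields.RamifiedPlaceFixedValuationParity

variable (L : Type) [Field L] [NumberField L] [IsCMField L] (v : HeightOneSpectrum (𝓞 ↥(maximalRealSubfield L)))
  (w : PlacesOver L v) (hw : IsCMField.complexConj L • w.1 = w.1)
/-! ## §0 Letters: powers of `|ϖ|`, the level-one witness, the level of the scaled base `lᵗ·a(x)` -/
omit [IsCMField L] in
/-- `|ϖ|^n = exp(−n)` for `|ϖ| = exp(−1)`. [cite: WeilBNT1967, Ch. I §2] -/
theorem valued_uniformizer_pow_eq_exp {ϖ : w.1.adicCompletion L} (hϖ : Valued.v ϖ = WithZero.exp (-1 : ℤ)) (n : ℕ) :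
    Valued.v ϖ ^ n = WithZero.exp (-(n : ℤ)) := by
  rw [hϖ, ← WithZero.exp_nsmul, nsmul_eq_mul, mul_neg, mul_one]
omit [IsCMField L] in
/-- J3: a level-`m` unit (`|u₁ w′ − 1| ≤ |ϖ|^m`, `1 ≤ m`) is a level-ONE unit (`≤ |ϖ|`). [cite: WeilBNT1967, Ch. II §5] -/
theorem principal_of_level {ϖ : w.1.adicCompletion L} (hϖ : Valued.v ϖ = WithZero.exp (-1 : ℤ)) {m : ℕ} (hm : 1 ≤ m)
    (u₁ : (LocalRing L v)ˣ) (hu₁ : ∀ w' : PlacesOver L v, Valued.v (((u₁ : LocalRing L v) w') - 1) ≤ Valued.v ϖ ^ m) (w' : PlacesOver L v) :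
    Valued.v (((u₁ : LocalRing L v) w') - 1) ≤ Valued.v ϖ := by
  refine (hu₁ w').trans ?_
  rw [valued_uniformizer_pow_eq_exp L v w hϖ m, hϖ, WithZero.exp_le_exp]; omega
include hw in
/-- The scaled base against a level: `|x_w|² ≤ exp(2κ+1 − N)` (resp. `=`, resp. `>` with `N := m+1`) puts `l^{κ+1}·a(x)` at level `≤ |ϖ|^(m+2)` (resp. `= |ϖ|^(m+1)`, resp. `> |ϖ|^(m+1)`).
[cite: Rogawski1990, §12.2 (2) p. 173] [cite: Keys1984, §7 Theorem (2) (d) p. 126] -/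
theorem scaledBase_level_trichotomy (l : (LocalRing L v)ˣ) (hlv : Valued.v ((l : LocalRing L v) w) = WithZero.exp (-2 : ℤ))
    {c : LocalRing L v} (hcw : Valued.v (c w) = 1) {ϖ : w.1.adicCompletion L} (hϖ : Valued.v ϖ = WithZero.exp (-1 : ℤ)) (m κ : ℕ) (x : LocalRing L v) :
    (Valued.v (x w) * Valued.v (x w) ≤ WithZero.exp ((2 * (κ : ℤ) + 1) - ((m + 1 : ℕ) : ℤ)) →
        Valued.v (((((l ^ (κ + 1) : (LocalRing L v)ˣ)) : LocalRing L v) * (-(x * conjLocal L (IsCMField.complexConj L) v x) * c)) w) ≤ Valued.v ϖ ^ (m + 2)) ∧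
      (Valued.v (x w) * Valued.v (x w) = WithZero.exp ((2 * (κ : ℤ) + 1) - ((m + 1 : ℕ) : ℤ) + 1) →
        Valued.v (((((l ^ (κ + 1) : (LocalRing L v)ˣ)) : LocalRing L v) * (-(x * conjLocal L (IsCMField.complexConj L) v x) * c)) w) = Valued.v ϖ ^ (m + 1)) ∧
      (WithZero.exp ((2 * (κ : ℤ) + 1) - ((m + 1 : ℕ) : ℤ) + 1) < Valued.v (x w) * Valued.v (x w) →
        Valued.v ϖ ^ (m + 1) < Valued.v (((((l ^ (κ + 1) : (LocalRing L v)ˣ)) : LocalRing L v) * (-(x * conjLocal L (IsCMField.complexConj L) v x) * c)) w)) := by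
  rw [valued_units_pow_mul_apply_ram L v w l hlv _ (κ + 1), valued_neg_mul_conj_mul_apply L v w hw hcw x, valued_uniformizer_pow_eq_exp L v w hϖ (m + 2),
    valued_uniformizer_pow_eq_exp L v w hϖ (m + 1)]
  have hexp0 : WithZero.exp ((2 * (κ + 1) : ℕ) : ℤ) ≠ 0 := WithZero.exp_ne_zero
  by_cases hx0 : Valued.v (x w) * Valued.v (x w) = 0
  · rw [hx0, mul_zero]
    exact ⟨fun _ => zero_le, fun h => absurd h.symm WithZero.exp_ne_zero, fun h => absurd h (not_lt.2 zero_le)⟩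
  · -- `|x|² = exp e` for some `e : ℤ`
    have hV : WithZero.exp (WithZero.log (Valued.v (x w) * Valued.v (x w))) = Valued.v (x w) * Valued.v (x w) := WithZero.exp_log hx0
    rw [← hV, ← WithZero.exp_neg, ← WithZero.exp_add]
    simp only [WithZero.exp_le_exp, WithZero.exp_inj, WithZero.exp_lt_exp]
    refine ⟨fun h => ?_, fun h => ?_, fun h => ?_⟩
    · push_cast at h ⊢; omega
    · push_cast at h ⊢; omega
    · push_cast at h ⊢; omega
/-! ## §1 On the level-one sphere `F₀(a′ + s) = q·Ē(a′ − s)`; the sphere integral of `F₀` is `q·Φ(a′)` -/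
section Sphere
variable [MeasurableSpace (LocalRing L v)] [BorelSpace (LocalRing L v)]
  (μY : Measure ↥(HeisRing.skewPart (conjLocal L (IsCMField.complexConj L) v)))
include hw in
/-- The skew spheres `{s ∈ R⁻ : |s_w| = exp t}` are Borel (★ (A) `measurableSet_setOf_valued_add_eq_exp` at base `0`, pulled back to `R⁻`). [cite: Rogawski1990, §1.10 p. 9] -/
theorem measurableSet_skewSphere (t : ℤ) :
    MeasurableSet {s : ↥(HeisRing.skewPart (conjLocal L (IsCMField.complexConj L) v)) | Valued.v ((s : LocalRing L v) w) = WithZero.exp t} := by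
  have h := measurable_subtype_coe (BposRamShellMeasurability.measurableSet_setOf_valued_add_eq_exp L v w hw (0 : LocalRing L v) t)
    (p := fun z : LocalRing L v => z ∈ HeisRing.skewPart (conjLocal L (IsCMField.complexConj L) v))
  simpa only [Set.preimage_setOf_eq, zero_add] using h
open scoped Classical in
omit [MeasurableSpace (LocalRing L v)] [BorelSpace (LocalRing L v)] in
include hw in
/-- **ON THE LEVEL-ONE SPHERE `F₀(a′ + s) = q·Ē(a′ − s)`**: for a `σ`-fixed `a′` with `|a′_w| ≤ exp(−2)` and a skew `s` with `|s_w| = exp(−1)`, `z := a′ + s` has `|z_w| = exp(−1)` (max formula), so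
`z` is a unit, `σz = a′ − s`, `χ₁((σẑ)⁻¹) = Ē(a′ − s)` and `‖ẑ‖_R⁻¹ = N𝔓_w = N𝔭_v` (★ `unitModulusChar_eq_inv_absNorm_of_valued_eq`, ★ `absNorm_placesOver_eq_of_ramified`).
[cite: Keys1984, §4] [cite: Rogawski1990, §12.2 (2) p. 173] -/
theorem dite_F₀_fixed_add_skew_eq_of_sphere (he : v.asIdeal.ramificationIdx' w.1.asIdeal ≠ 1) (h2w : Valued.v (2 : w.1.adicCompletion L) = 1)
    (χ₁ : (LocalRing L v)ˣ →* ℂˣ) {a : LocalRing L v} (ha : conjLocal L (IsCMField.complexConj L) v a = a) (hav : Valued.v (a w) ≤ WithZero.exp (-2 : ℤ))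
    (s : ↥(HeisRing.skewPart (conjLocal L (IsCMField.complexConj L) v))) (hs : Valued.v ((s : LocalRing L v) w) = WithZero.exp (-1 : ℤ)) :
    (fun z : LocalRing L v =>
        if h : IsUnit z then
          ((((χ₁ (Units.map ((conjLocal L (IsCMField.complexConj L) v) : LocalRing L v →* LocalRing L v) h.unit))⁻¹ : ℂˣ) : ℂ) *
            ((((unitModulusChar (LocalRing L v) h.unit)⁻¹ : ℝ≥0) : ℝ) : ℂ))
        else 0) (a + (s : LocalRing L v)) =
      ((Ideal.absNorm v.asIdeal : ℝ) : ℂ) * (fun r : LocalRing L v => if h : IsUnit r then (((χ₁ h.unit)⁻¹ : ℂˣ) : ℂ) else 0) (a - (s : LocalRing L v)) := by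
  haveI : Algebra.IsQuadraticExtension ↥(maximalRealSubfield L) L := IsCMField.isQuadraticExtension L
  have hσa : galAdicCompletionMap (L := L) (IsCMField.complexConj L) hw (a w) = a w := by
    rw [← conjLocal_apply_eq_of_smul_eq (IsCMField.complexConj L) (IsCMField.complexConj_ne_one L) v w hw, ha]
  have hσs : galAdicCompletionMap (L := L) (IsCMField.complexConj L) hw ((s : LocalRing L v) w) = -((s : LocalRing L v) w) := by
    rw [← conjLocal_apply_eq_of_smul_eq (IsCMField.complexConj L) (IsCMField.complexConj_ne_one L) v w hw, (HeisRing.mem_skewPart_iff _ _).1 s.2, Pi.neg_apply]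
  have hzv : Valued.v ((a + (s : LocalRing L v)) w) = WithZero.exp (-1 : ℤ) := by
    rw [Pi.add_apply, valued_fixed_add_skew_eq_max_ram L w hw he h2w hσa hσs, hs]
    exact max_eq_right (hav.trans (WithZero.exp_le_exp.2 (by norm_num)))
  have hz0 : (a + (s : LocalRing L v)) w ≠ 0 := fun h => by rw [h, map_zero] at hzv; exact WithZero.exp_ne_zero hzv.symm
  have hzU : IsUnit (a + (s : LocalRing L v)) := K2E3DepthZeroIwahoriCharacterCM.isUnit_of_apply_ne_zero L v w hw _ hz0
  have hσz : conjLocal L (IsCMField.complexConj L) v (a + (s : LocalRing L v)) = a - (s : LocalRing L v) := by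
    rw [map_add, ha, (HeisRing.mem_skewPart_iff _ _).1 s.2, sub_eq_add_neg]
  have hz'U : IsUnit (a - (s : LocalRing L v)) := by rw [← hσz]; exact hzU.map _
  have hunits : Units.map ((conjLocal L (IsCMField.complexConj L) v) : LocalRing L v →* LocalRing L v) hzU.unit = hz'U.unit :=
    Units.ext (by rw [Units.coe_map, MonoidHom.coe_coe, IsUnit.unit_spec, IsUnit.unit_spec, hσz])
  have hmod : unitModulusChar (LocalRing L v) hzU.unit = ((Ideal.absNorm w.1.asIdeal : ℝ≥0))⁻¹ :=
    unitModulusChar_eq_inv_absNorm_of_valued_eq L v w hw hzU.unit (by rw [IsUnit.unit_spec]; exact hzv)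
  beta_reduce
  rw [dif_pos hzU, dif_pos hz'U, hunits, hmod, inv_inv, NNReal.coe_natCast, Rogawski1990.absNorm_placesOver_eq_of_ramified L v w hw he, mul_comm]
open scoped Classical in
include hw in
/-- **`∫_{|s_w| = exp(−1)} F₀(a′ + s) dμ⁻ = q · Φ(a′)`**, `Φ(a′) := ∫_{|s_w| = exp(−1)} Ē(a′ − s) dμ⁻` ((6a)'s level-one sphere integral), for a `σ`-fixed `a′` with `|a′_w| ≤ exp(−2)`;
any measure `μ⁻` on `R⁻`. [cite: Keys1984, §4–§5] [cite: Rogawski1990, §12.2 (2) p. 173] [cite: WeilBNT1967, Ch. II §5] -/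
theorem setIntegral_sphere_F₀_add_eq_mul_sphere_diteInv_sub (he : v.asIdeal.ramificationIdx' w.1.asIdeal ≠ 1) (h2w : Valued.v (2 : w.1.adicCompletion L) = 1)
    (χ₁ : (LocalRing L v)ˣ →* ℂˣ) {a : LocalRing L v} (ha : conjLocal L (IsCMField.complexConj L) v a = a) (hav : Valued.v (a w) ≤ WithZero.exp (-2 : ℤ)) :
    ∫ s in {s : ↥(HeisRing.skewPart (conjLocal L (IsCMField.complexConj L) v)) | Valued.v ((s : LocalRing L v) w) = WithZero.exp (-1 : ℤ)},
        (fun z : LocalRing L v =>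
          if h : IsUnit z then
            ((((χ₁ (Units.map ((conjLocal L (IsCMField.complexConj L) v) : LocalRing L v →* LocalRing L v) h.unit))⁻¹ : ℂˣ) : ℂ) *
              ((((unitModulusChar (LocalRing L v) h.unit)⁻¹ : ℝ≥0) : ℝ) : ℂ))
          else 0) (a + (s : LocalRing L v)) ∂μY =
      ((Ideal.absNorm v.asIdeal : ℝ) : ℂ) *
        ∫ s in {s : ↥(HeisRing.skewPart (conjLocal L (IsCMField.complexConj L) v)) | Valued.v ((s : LocalRing L v) w) = WithZero.exp (-1 : ℤ)},
          (fun r : LocalRing L v => if h : IsUnit r then (((χ₁ h.unit)⁻¹ : ℂˣ) : ℂ) else 0) (a - (s : LocalRing L v)) ∂μY := by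
  rw [← integral_const_mul]
  refine setIntegral_congr_fun (measurableSet_skewSphere L v w hw (-1)) fun s hs => ?_
  exact dite_F₀_fixed_add_skew_eq_of_sphere L v w hw he h2w χ₁ ha hav s hs
end Sphere
/-! ## §2 The κ-rows of the fibre over `a(x) = −(x·σx)·c` -/
section Rows
variable [MeasurableSpace (LocalRing L v)] [BorelSpace (LocalRing L v)]
  (μY : Measure ↥(HeisRing.skewPart (conjLocal L (IsCMField.complexConj L) v))) [μY.IsAddHaarMeasure] [μY.Regular]
open scoped Classical in
include hw in
/-- **EVEN ROW**: `∫_{|a(x)+y|_w = exp(2κ)} F₀(a(x)+y) dμ⁻ = 0` for every `x` at positive depth (★ PART 1 §3 at the `σ`-fixed base `a(x)`, level-one witness by J3).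
[cite: Keys1984, §7 Theorem (2) (d) p. 126] [cite: Rogawski1990, §12.2 (2) p. 173] -/
theorem fibreRow_even (he : v.asIdeal.ramificationIdx' w.1.asIdeal ≠ 1) (h2w : Valued.v (2 : w.1.adicCompletion L) = 1)
    (χ₁ : (LocalRing L v)ˣ →* ℂˣ) (h₁ : Continuous fun x => ((χ₁ x : ℂˣ) : ℂ))
    (hfixP : ∀ u : (LocalRing L v)ˣ, (∀ w' : PlacesOver L v, Valued.v (((u : LocalRing L v) w') - 1) < 1) →
      conjLocal L (IsCMField.complexConj L) v (u : LocalRing L v) = u → χ₁ u = 1)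
    {ϖ : w.1.adicCompletion L} (hϖ : Valued.v ϖ = WithZero.exp (-1 : ℤ)) {m : ℕ} (hm : 1 ≤ m)
    (u₁ : (LocalRing L v)ˣ) (hu₁ : ∀ w' : PlacesOver L v, Valued.v (((u₁ : LocalRing L v) w') - 1) ≤ Valued.v ϖ ^ m) (hχu₁ : χ₁ u₁ ≠ 1)
    {c : LocalRing L v} (hcσ : conjLocal L (IsCMField.complexConj L) v c = c) (κ : ℕ) (x : LocalRing L v) :
    ∫ y in {y : ↥(HeisRing.skewPart (conjLocal L (IsCMField.complexConj L) v)) |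
        Valued.v ((-(x * conjLocal L (IsCMField.complexConj L) v x) * c + (y : LocalRing L v)) w) = WithZero.exp (2 * (κ : ℤ))},
      (fun z : LocalRing L v =>
        if h : IsUnit z then
          ((((χ₁ (Units.map ((conjLocal L (IsCMField.complexConj L) v) : LocalRing L v →* LocalRing L v) h.unit))⁻¹ : ℂˣ) : ℂ) *
            ((((unitModulusChar (LocalRing L v) h.unit)⁻¹ : ℝ≥0) : ℝ) : ℂ))
        else 0) (-(x * conjLocal L (IsCMField.complexConj L) v x) * c + (y : LocalRing L v)) ∂μY = 0 :=
  setIntegral_evenShellFibre_eq_zero_ram L v w hw μY he h2w χ₁ h₁ hfixP hϖ u₁ (principal_of_level L v w hϖ hm u₁ hu₁) hχu₁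
    (conjLocal_neg_mul_conj_mul_of_fixed L v hcσ x) κ
open scoped Classical in
include hw in
/-- THE ODD FIBRE BELOW ITS BASE, CONVERTED: for `|x_w|² < exp(2κ+1)`, `∫_{|a(x)+y|_w = exp(2κ+1)} F₀(a(x)+y) dμ⁻ = X^{κ+1}·(q⁻¹)^κ·Φ(l^{κ+1}·a(x))` (★ FILE 2 §3, then §1 at
the scaled base, `(q⁻¹)^{κ+1}·q = (q⁻¹)^κ`). [cite: Keys1984, §4, §7 Theorem (2) (d) p. 126] [cite: Rogawski1990, §12.2 (2) p. 173] -/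
theorem fibreRow_odd_eq_sphere (he : v.asIdeal.ramificationIdx' w.1.asIdeal ≠ 1) (h2w : Valued.v (2 : w.1.adicCompletion L) = 1)
    (χ₁ : (LocalRing L v)ˣ →* ℂˣ)
    (l : (LocalRing L v)ˣ) (hlσ : conjLocal L (IsCMField.complexConj L) v (l : LocalRing L v) = l) (hlv : Valued.v ((l : LocalRing L v) w) = WithZero.exp (-2 : ℤ))
    (hlm : unitModulusChar (LocalRing L v) l = ((Ideal.absNorm v.asIdeal : ℝ≥0) ^ 2)⁻¹)
    {c : LocalRing L v} (hcσ : conjLocal L (IsCMField.complexConj L) v c = c) (hcw : Valued.v (c w) = 1) (κ : ℕ) (x : LocalRing L v)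
    (hx : Valued.v (x w) * Valued.v (x w) < WithZero.exp (2 * (κ : ℤ) + 1)) :
    ∫ y in {y : ↥(HeisRing.skewPart (conjLocal L (IsCMField.complexConj L) v)) |
        Valued.v ((-(x * conjLocal L (IsCMField.complexConj L) v x) * c + (y : LocalRing L v)) w) = WithZero.exp (2 * (κ : ℤ) + 1)},
      (fun z : LocalRing L v =>
        if h : IsUnit z then
          ((((χ₁ (Units.map ((conjLocal L (IsCMField.complexConj L) v) : LocalRing L v →* LocalRing L v) h.unit))⁻¹ : ℂˣ) : ℂ) *
            ((((unitModulusChar (LocalRing L v) h.unit)⁻¹ : ℝ≥0) : ℝ) : ℂ))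
        else 0) (-(x * conjLocal L (IsCMField.complexConj L) v x) * c + (y : LocalRing L v)) ∂μY =
      ((χ₁ l : ℂˣ) : ℂ) ^ (κ + 1) * (((Ideal.absNorm v.asIdeal : ℝ) : ℂ)⁻¹) ^ κ *
        ∫ s in {s : ↥(HeisRing.skewPart (conjLocal L (IsCMField.complexConj L) v)) | Valued.v ((s : LocalRing L v) w) = WithZero.exp (-1 : ℤ)},
          (fun r : LocalRing L v => if h : IsUnit r then (((χ₁ h.unit)⁻¹ : ℂˣ) : ℂ) else 0)
            ((((l ^ (κ + 1) : (LocalRing L v)ˣ)) : LocalRing L v) * (-(x * conjLocal L (IsCMField.complexConj L) v x) * c) - (s : LocalRing L v)) ∂μY := by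
  have ha := conjLocal_neg_mul_conj_mul_of_fixed L v hcσ x
  have hav : Valued.v ((-(x * conjLocal L (IsCMField.complexConj L) v x) * c) w) < WithZero.exp (2 * (κ : ℤ) + 1) := by
    rw [valued_neg_mul_conj_mul_apply L v w hw hcw x]; exact hx
  rw [setIntegral_oddShellFibre_eq_scale_sphere_ram L v w hw μY he h2w χ₁ l hlσ hlv hlm ha κ hav,
    setIntegral_sphere_F₀_add_eq_mul_sphere_diteInv_sub L v w hw μY he h2w χ₁ (conjLocal_units_pow_mul_of_fixed L v l hlσ ha (κ + 1))
      (valued_units_pow_succ_mul_fixed_ram L v w hw he l hlσ hlv ha κ hav).2]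
  have hq : ((Ideal.absNorm v.asIdeal : ℝ) : ℂ) ≠ 0 := by exact_mod_cast fun h => v.ne_bot (Ideal.absNorm_eq_zero_iff.1 h)
  rw [mul_assoc ((((χ₁ l : ℂˣ) : ℂ)) ^ (κ + 1)), mul_assoc ((((χ₁ l : ℂˣ) : ℂ)) ^ (κ + 1))]
  congr 1
  rw [pow_succ, mul_assoc, ← mul_assoc ((((Ideal.absNorm v.asIdeal : ℝ) : ℂ))⁻¹), inv_mul_cancel₀ hq, one_mul]

variable (χ₁ : (LocalRing L v)ˣ →* ℂˣ)
  (l : (LocalRing L v)ˣ) (hlσ : conjLocal L (IsCMField.complexConj L) v (l : LocalRing L v) = l) (hlv : Valued.v ((l : LocalRing L v) w) = WithZero.exp (-2 : ℤ))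
  (hlm : unitModulusChar (LocalRing L v) l = ((Ideal.absNorm v.asIdeal : ℝ≥0) ^ 2)⁻¹)
  {c : LocalRing L v} (hcσ : conjLocal L (IsCMField.complexConj L) v c = c) (hcw : Valued.v (c w) = 1)
  {ϖ : w.1.adicCompletion L} (hϖ : Valued.v ϖ = WithZero.exp (-1 : ℤ)) (m : ℕ) (Φdeep Φcrit : ℂ)

open scoped Classical in
include hw hlσ hlv hlm hcσ hcw hϖ in
/-- **ODD ROW, DEEP**: `|x_w|² ≤ exp(2κ+1 − N)` (`N = m+1`) ⇒ the fibre is `X^{κ+1}·(q⁻¹)^κ·Φdeep` (the scaled base sits at level `≤ |ϖ|^(m+2)`; letter `hΦdeep`).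
[cite: Keys1984, §4–§5, §7 Theorem (2) (d) p. 126] [cite: Rogawski1990, §12.2 (2) p. 173] -/
theorem fibreRow_odd_deep (he : v.asIdeal.ramificationIdx' w.1.asIdeal ≠ 1) (h2w : Valued.v (2 : w.1.adicCompletion L) = 1)
    (hΦdeep : ∀ (t : ℕ) (x : LocalRing L v),
      Valued.v (((((l ^ t : (LocalRing L v)ˣ)) : LocalRing L v) * (-(x * conjLocal L (IsCMField.complexConj L) v x) * c)) w) ≤ Valued.v ϖ ^ (m + 2) →
      ∫ s in {s : ↥(HeisRing.skewPart (conjLocal L (IsCMField.complexConj L) v)) | Valued.v ((s : LocalRing L v) w) = WithZero.exp (-1 : ℤ)},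
          (fun r : LocalRing L v => if h : IsUnit r then (((χ₁ h.unit)⁻¹ : ℂˣ) : ℂ) else 0)
            ((((l ^ t : (LocalRing L v)ˣ)) : LocalRing L v) * (-(x * conjLocal L (IsCMField.complexConj L) v x) * c) - (s : LocalRing L v)) ∂μY = Φdeep)
    (κ : ℕ) (x : LocalRing L v) (hx : Valued.v (x w) * Valued.v (x w) ≤ WithZero.exp ((2 * (κ : ℤ) + 1) - ((m + 1 : ℕ) : ℤ))) :
    ∫ y in {y : ↥(HeisRing.skewPart (conjLocal L (IsCMField.complexConj L) v)) |
        Valued.v ((-(x * conjLocal L (IsCMField.complexConj L) v x) * c + (y : LocalRing L v)) w) = WithZero.exp (2 * (κ : ℤ) + 1)},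
      (fun z : LocalRing L v =>
        if h : IsUnit z then
          ((((χ₁ (Units.map ((conjLocal L (IsCMField.complexConj L) v) : LocalRing L v →* LocalRing L v) h.unit))⁻¹ : ℂˣ) : ℂ) *
            ((((unitModulusChar (LocalRing L v) h.unit)⁻¹ : ℝ≥0) : ℝ) : ℂ))
        else 0) (-(x * conjLocal L (IsCMField.complexConj L) v x) * c + (y : LocalRing L v)) ∂μY =
      ((χ₁ l : ℂˣ) : ℂ) ^ (κ + 1) * (((Ideal.absNorm v.asIdeal : ℝ) : ℂ)⁻¹) ^ κ * Φdeep := by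
  have hlt : Valued.v (x w) * Valued.v (x w) < WithZero.exp (2 * (κ : ℤ) + 1) :=
    hx.trans_lt (WithZero.exp_lt_exp.2 (by push_cast; omega))
  rw [fibreRow_odd_eq_sphere L v w hw μY he h2w χ₁ l hlσ hlv hlm hcσ hcw κ x hlt,
    hΦdeep (κ + 1) x ((scaledBase_level_trichotomy L v w hw l hlv hcw hϖ m κ x).1 hx)]
open scoped Classical in
include hw hlσ hlv hlm hcσ hcw hϖ in
/-- **ODD ROW, CRITICAL**: `|x_w|² = exp(2κ+1 − N + 1)` ⇒ the fibre is `X^{κ+1}·(q⁻¹)^κ·Φcrit` (the scaled base sits at level `|ϖ|^(m+1)`; letter `hΦcrit`).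
[cite: Keys1984, §4–§5, §7 Theorem (2) (d) p. 126] [cite: Rogawski1990, §12.2 (2) p. 173] -/
theorem fibreRow_odd_crit (he : v.asIdeal.ramificationIdx' w.1.asIdeal ≠ 1) (h2w : Valued.v (2 : w.1.adicCompletion L) = 1) (hm : 1 ≤ m)
    (hΦcrit : ∀ (t : ℕ) (x : LocalRing L v),
      Valued.v (((((l ^ t : (LocalRing L v)ˣ)) : LocalRing L v) * (-(x * conjLocal L (IsCMField.complexConj L) v x) * c)) w) = Valued.v ϖ ^ (m + 1) →
      ∫ s in {s : ↥(HeisRing.skewPart (conjLocal L (IsCMField.complexConj L) v)) | Valued.v ((s : LocalRing L v) w) = WithZero.exp (-1 : ℤ)},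
          (fun r : LocalRing L v => if h : IsUnit r then (((χ₁ h.unit)⁻¹ : ℂˣ) : ℂ) else 0)
            ((((l ^ t : (LocalRing L v)ˣ)) : LocalRing L v) * (-(x * conjLocal L (IsCMField.complexConj L) v x) * c) - (s : LocalRing L v)) ∂μY = Φcrit)
    (κ : ℕ) (x : LocalRing L v) (hx : Valued.v (x w) * Valued.v (x w) = WithZero.exp ((2 * (κ : ℤ) + 1) - ((m + 1 : ℕ) : ℤ) + 1)) :
    ∫ y in {y : ↥(HeisRing.skewPart (conjLocal L (IsCMField.complexConj L) v)) |
        Valued.v ((-(x * conjLocal L (IsCMField.complexConj L) v x) * c + (y : LocalRing L v)) w) = WithZero.exp (2 * (κ : ℤ) + 1)},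
      (fun z : LocalRing L v =>
        if h : IsUnit z then
          ((((χ₁ (Units.map ((conjLocal L (IsCMField.complexConj L) v) : LocalRing L v →* LocalRing L v) h.unit))⁻¹ : ℂˣ) : ℂ) *
            ((((unitModulusChar (LocalRing L v) h.unit)⁻¹ : ℝ≥0) : ℝ) : ℂ))
        else 0) (-(x * conjLocal L (IsCMField.complexConj L) v x) * c + (y : LocalRing L v)) ∂μY =
      ((χ₁ l : ℂˣ) : ℂ) ^ (κ + 1) * (((Ideal.absNorm v.asIdeal : ℝ) : ℂ)⁻¹) ^ κ * Φcrit := by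
  have hlt : Valued.v (x w) * Valued.v (x w) < WithZero.exp (2 * (κ : ℤ) + 1) := by
    rw [hx, WithZero.exp_lt_exp]; push_cast; omega
  rw [fibreRow_odd_eq_sphere L v w hw μY he h2w χ₁ l hlσ hlv hlm hcσ hcw κ x hlt,
    hΦcrit (κ + 1) x ((scaledBase_level_trichotomy L v w hw l hlv hcw hϖ m κ x).2.1 hx)]
open scoped Classical in
include hw hlσ hlv hlm hcσ hcw hϖ in
/-- **ODD ROW, LOW** (shallow or empty): `exp(2κ+1 − N + 1) < |x_w|²` ⇒ the fibre is `0` — below `|x_w|² < exp(2κ+1)` the scaled base is shallow (`|ϖ|^(m+1) < level ≤ |ϖ|^2`, letter `hΦsh`);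
above, the fibre is EMPTY (★ FILE 2; `|x_w|² = exp(2κ+1)` is excluded by parity). [cite: Keys1984, §4–§5, §7 Theorem (2) (d) p. 126] [cite: Rogawski1990, §1.10 p. 9, §12.2 (2) p. 173] -/
theorem fibreRow_odd_lo (he : v.asIdeal.ramificationIdx' w.1.asIdeal ≠ 1) (h2w : Valued.v (2 : w.1.adicCompletion L) = 1)
    (hΦsh : ∀ (t : ℕ) (x : LocalRing L v),
      Valued.v ϖ ^ (m + 1) < Valued.v (((((l ^ t : (LocalRing L v)ˣ)) : LocalRing L v) * (-(x * conjLocal L (IsCMField.complexConj L) v x) * c)) w) →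
      Valued.v (((((l ^ t : (LocalRing L v)ˣ)) : LocalRing L v) * (-(x * conjLocal L (IsCMField.complexConj L) v x) * c)) w) ≤ Valued.v ϖ ^ 2 →
      ∫ s in {s : ↥(HeisRing.skewPart (conjLocal L (IsCMField.complexConj L) v)) | Valued.v ((s : LocalRing L v) w) = WithZero.exp (-1 : ℤ)},
          (fun r : LocalRing L v => if h : IsUnit r then (((χ₁ h.unit)⁻¹ : ℂˣ) : ℂ) else 0)
            ((((l ^ t : (LocalRing L v)ˣ)) : LocalRing L v) * (-(x * conjLocal L (IsCMField.complexConj L) v x) * c) - (s : LocalRing L v)) ∂μY = 0)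
    (κ : ℕ) (x : LocalRing L v) (hx : WithZero.exp ((2 * (κ : ℤ) + 1) - ((m + 1 : ℕ) : ℤ) + 1) < Valued.v (x w) * Valued.v (x w)) :
    ∫ y in {y : ↥(HeisRing.skewPart (conjLocal L (IsCMField.complexConj L) v)) |
        Valued.v ((-(x * conjLocal L (IsCMField.complexConj L) v x) * c + (y : LocalRing L v)) w) = WithZero.exp (2 * (κ : ℤ) + 1)},
      (fun z : LocalRing L v =>
        if h : IsUnit z then
          ((((χ₁ (Units.map ((conjLocal L (IsCMField.complexConj L) v) : LocalRing L v →* LocalRing L v) h.unit))⁻¹ : ℂˣ) : ℂ) *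
            ((((unitModulusChar (LocalRing L v) h.unit)⁻¹ : ℝ≥0) : ℝ) : ℂ))
        else 0) (-(x * conjLocal L (IsCMField.complexConj L) v x) * c + (y : LocalRing L v)) ∂μY = 0 := by
  have ha := conjLocal_neg_mul_conj_mul_of_fixed L v hcσ x
  have haV := valued_neg_mul_conj_mul_apply L v w hw hcw x
  by_cases hlt : Valued.v (x w) * Valued.v (x w) < WithZero.exp (2 * (κ : ℤ) + 1)
  · -- shallow: the scaled base is above the critical level and (parity) at most `exp(−2)`
    have hav : Valued.v ((-(x * conjLocal L (IsCMField.complexConj L) v x) * c) w) < WithZero.exp (2 * (κ : ℤ) + 1) := by rw [haV]; exact hlt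
    have h2 : Valued.v (((((l ^ (κ + 1) : (LocalRing L v)ˣ)) : LocalRing L v) * (-(x * conjLocal L (IsCMField.complexConj L) v x) * c)) w) ≤ Valued.v ϖ ^ 2 := by
      rw [valued_uniformizer_pow_eq_exp L v w hϖ 2]; exact_mod_cast (valued_units_pow_succ_mul_fixed_ram L v w hw he l hlσ hlv ha κ hav).2
    rw [fibreRow_odd_eq_sphere L v w hw μY he h2w χ₁ l hlσ hlv hlm hcσ hcw κ x hlt,
      hΦsh (κ + 1) x ((scaledBase_level_trichotomy L v w hw l hlv hcw hϖ m κ x).2.2 hx) h2, mul_zero]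
  · -- empty: `exp(2κ+1) < |a(x)_w|` (equality excluded by parity)
    have hne := valued_fixed_ne_exp_odd_ram L v w hw he ha (κ : ℤ)
    have hgt : WithZero.exp (2 * (κ : ℤ) + 1) < Valued.v ((-(x * conjLocal L (IsCMField.complexConj L) v x) * c) w) := by
      rw [haV] at hne ⊢; exact lt_of_le_of_ne (not_lt.1 hlt) (Ne.symm hne)
    exact setIntegral_shellFibre_eq_zero_of_exp_lt_ram L v w hw μY he h2w ha hgt _
end Rows
/-! ## §3 THE THREE ROWS IN (B)'s BINDER SHAPES (`N := m + 1`, `A j`, `B j` explicit) -/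
section BRows
variable [MeasurableSpace (LocalRing L v)] [BorelSpace (LocalRing L v)]
  (μY : Measure ↥(HeisRing.skewPart (conjLocal L (IsCMField.complexConj L) v))) [μY.IsAddHaarMeasure] [μY.Regular]
  (χ₁ : (LocalRing L v)ˣ →* ℂˣ) (h₁ : Continuous fun x => ((χ₁ x : ℂˣ) : ℂ))
  (hfixP : ∀ u : (LocalRing L v)ˣ, (∀ w' : PlacesOver L v, Valued.v (((u : LocalRing L v) w') - 1) < 1) →
    conjLocal L (IsCMField.complexConj L) v (u : LocalRing L v) = u → χ₁ u = 1)
  {ϖ : w.1.adicCompletion L} (hϖ : Valued.v ϖ = WithZero.exp (-1 : ℤ)) {m : ℕ} (hm : 1 ≤ m)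
  (u₁ : (LocalRing L v)ˣ) (hu₁ : ∀ w' : PlacesOver L v, Valued.v (((u₁ : LocalRing L v) w') - 1) ≤ Valued.v ϖ ^ m) (hχu₁ : χ₁ u₁ ≠ 1)
  (l : (LocalRing L v)ˣ) (hlσ : conjLocal L (IsCMField.complexConj L) v (l : LocalRing L v) = l) (hlv : Valued.v ((l : LocalRing L v) w) = WithZero.exp (-2 : ℤ))
  (hlm : unitModulusChar (LocalRing L v) l = ((Ideal.absNorm v.asIdeal : ℝ≥0) ^ 2)⁻¹)
  {c : LocalRing L v} (hcσ : conjLocal L (IsCMField.complexConj L) v c = c) (hcw : Valued.v (c w) = 1) (Φdeep Φcrit : ℂ)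

omit [IsCMField L] in
/-- parity bookkeeping: `(j : ℤ) = 2·(j∕2)` for even `j`, `= 2·(j∕2) + 1` for odd `j`. [folklore] -/
theorem natCast_eq_two_mul_div_two (j : ℕ) : (Even j → (j : ℤ) = 2 * ((j / 2 : ℕ) : ℤ)) ∧ (¬ Even j → (j : ℤ) = 2 * ((j / 2 : ℕ) : ℤ) + 1) := by
  refine ⟨fun ⟨r, hr⟩ => by omega, fun h => ?_⟩
  rw [Nat.not_even_iff_odd] at h; obtain ⟨r, hr⟩ := h; omega
open scoped Classical in
include hw h₁ hfixP hϖ hm hu₁ hχu₁ hlσ hlv hlm hcσ hcw in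
/-- **ROW `hfib_hi` OF ★ (B) `exists_haarScalar_setIntegral_shell_cutoff`** at `N := m + 1`, with **`A j := if Even j then 0 else X^(j∕2+1)·(q⁻¹)^(j∕2)·Φdeep`**:
`|x_w|² ≤ exp(j − N) ⇒ fibre(j, x) = A j`. [cite: Keys1984, §4–§5, §7 Theorem (2) (d) p. 126] [cite: Rogawski1990, §12.2 (2) p. 173] [cite: WeilBNT1967, Ch. II §5] -/
theorem fibreRows_hi (he : v.asIdeal.ramificationIdx' w.1.asIdeal ≠ 1) (h2w : Valued.v (2 : w.1.adicCompletion L) = 1)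
    (hΦdeep : ∀ (t : ℕ) (x : LocalRing L v),
      Valued.v (((((l ^ t : (LocalRing L v)ˣ)) : LocalRing L v) * (-(x * conjLocal L (IsCMField.complexConj L) v x) * c)) w) ≤ Valued.v ϖ ^ (m + 2) →
      ∫ s in {s : ↥(HeisRing.skewPart (conjLocal L (IsCMField.complexConj L) v)) | Valued.v ((s : LocalRing L v) w) = WithZero.exp (-1 : ℤ)},
          (fun r : LocalRing L v => if h : IsUnit r then (((χ₁ h.unit)⁻¹ : ℂˣ) : ℂ) else 0)
            ((((l ^ t : (LocalRing L v)ˣ)) : LocalRing L v) * (-(x * conjLocal L (IsCMField.complexConj L) v x) * c) - (s : LocalRing L v)) ∂μY = Φdeep) :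
    ∀ (j : ℕ) (x : LocalRing L v), Valued.v (x w) * Valued.v (x w) ≤ WithZero.exp ((j : ℤ) - ((m + 1 : ℕ) : ℤ)) →
      ∫ y in {y : ↥(HeisRing.skewPart (conjLocal L (IsCMField.complexConj L) v)) |
          Valued.v ((-(x * conjLocal L (IsCMField.complexConj L) v x) * c + (y : LocalRing L v)) w) = WithZero.exp (j : ℤ)},
        (fun z : LocalRing L v =>
          if h : IsUnit z then
            ((((χ₁ (Units.map ((conjLocal L (IsCMField.complexConj L) v) : LocalRing L v →* LocalRing L v) h.unit))⁻¹ : ℂˣ) : ℂ) *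
              ((((unitModulusChar (LocalRing L v) h.unit)⁻¹ : ℝ≥0) : ℝ) : ℂ))
          else 0) (-(x * conjLocal L (IsCMField.complexConj L) v x) * c + (y : LocalRing L v)) ∂μY =
        (if Even j then 0 else ((χ₁ l : ℂˣ) : ℂ) ^ (j / 2 + 1) * (((Ideal.absNorm v.asIdeal : ℝ) : ℂ)⁻¹) ^ (j / 2) * Φdeep) := by
  intro j x hx
  by_cases hj : Even j
  · rw [if_pos hj, (natCast_eq_two_mul_div_two j).1 hj]
    exact fibreRow_even L v w hw μY he h2w χ₁ h₁ hfixP hϖ hm u₁ hu₁ hχu₁ hcσ (j / 2) x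
  · have hj' := (natCast_eq_two_mul_div_two j).2 hj
    rw [if_neg hj, hj']
    rw [hj'] at hx
    exact fibreRow_odd_deep L v w hw μY χ₁ l hlσ hlv hlm hcσ hcw hϖ m Φdeep he h2w hΦdeep (j / 2) x hx
open scoped Classical in
include hw h₁ hfixP hϖ hm hu₁ hχu₁ hlσ hlv hlm hcσ hcw in
/-- **ROW `hfib_mid` OF ★ (B)** at `N := m + 1`, with **`B j := if Even j then 0 else X^(j∕2+1)·(q⁻¹)^(j∕2)·Φcrit`**: `|x_w|² = exp(j − N + 1) ⇒ fibre(j, x) = B j`.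
[cite: Keys1984, §4–§5, §7 Theorem (2) (d) p. 126] [cite: Rogawski1990, §12.2 (2) p. 173] [cite: WeilBNT1967, Ch. II §5] -/
theorem fibreRows_mid (he : v.asIdeal.ramificationIdx' w.1.asIdeal ≠ 1) (h2w : Valued.v (2 : w.1.adicCompletion L) = 1)
    (hΦcrit : ∀ (t : ℕ) (x : LocalRing L v),
      Valued.v (((((l ^ t : (LocalRing L v)ˣ)) : LocalRing L v) * (-(x * conjLocal L (IsCMField.complexConj L) v x) * c)) w) = Valued.v ϖ ^ (m + 1) →
      ∫ s in {s : ↥(HeisRing.skewPart (conjLocal L (IsCMField.complexConj L) v)) | Valued.v ((s : LocalRing L v) w) = WithZero.exp (-1 : ℤ)},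
          (fun r : LocalRing L v => if h : IsUnit r then (((χ₁ h.unit)⁻¹ : ℂˣ) : ℂ) else 0)
            ((((l ^ t : (LocalRing L v)ˣ)) : LocalRing L v) * (-(x * conjLocal L (IsCMField.complexConj L) v x) * c) - (s : LocalRing L v)) ∂μY = Φcrit) :
    ∀ (j : ℕ) (x : LocalRing L v), Valued.v (x w) * Valued.v (x w) = WithZero.exp ((j : ℤ) - ((m + 1 : ℕ) : ℤ) + 1) →
      ∫ y in {y : ↥(HeisRing.skewPart (conjLocal L (IsCMField.complexConj L) v)) |
          Valued.v ((-(x * conjLocal L (IsCMField.complexConj L) v x) * c + (y : LocalRing L v)) w) = WithZero.exp (j : ℤ)},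
        (fun z : LocalRing L v =>
          if h : IsUnit z then
            ((((χ₁ (Units.map ((conjLocal L (IsCMField.complexConj L) v) : LocalRing L v →* LocalRing L v) h.unit))⁻¹ : ℂˣ) : ℂ) *
              ((((unitModulusChar (LocalRing L v) h.unit)⁻¹ : ℝ≥0) : ℝ) : ℂ))
          else 0) (-(x * conjLocal L (IsCMField.complexConj L) v x) * c + (y : LocalRing L v)) ∂μY =
        (if Even j then 0 else ((χ₁ l : ℂˣ) : ℂ) ^ (j / 2 + 1) * (((Ideal.absNorm v.asIdeal : ℝ) : ℂ)⁻¹) ^ (j / 2) * Φcrit) := by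
  intro j x hx
  by_cases hj : Even j
  · rw [if_pos hj, (natCast_eq_two_mul_div_two j).1 hj]
    exact fibreRow_even L v w hw μY he h2w χ₁ h₁ hfixP hϖ hm u₁ hu₁ hχu₁ hcσ (j / 2) x
  · have hj' := (natCast_eq_two_mul_div_two j).2 hj
    rw [if_neg hj, hj']
    rw [hj'] at hx
    exact fibreRow_odd_crit L v w hw μY χ₁ l hlσ hlv hlm hcσ hcw hϖ m Φcrit he h2w hm hΦcrit (j / 2) x hx
open scoped Classical in
include hw h₁ hfixP hϖ hm hu₁ hχu₁ hlσ hlv hlm hcσ hcw in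
/-- **ROW `hfib_lo` OF ★ (B)** at `N := m + 1`: `exp(j − N + 1) < |x_w|² ⇒ fibre(j, x) = 0` (even `j`: ★ PART 1 §3; odd `j`: shallow letter or empty fibre).
[cite: Keys1984, §4–§5, §7 Theorem (2) (d) p. 126] [cite: Rogawski1990, §1.10 p. 9, §12.2 (2) p. 173] [cite: WeilBNT1967, Ch. II §5] -/
theorem fibreRows_lo (he : v.asIdeal.ramificationIdx' w.1.asIdeal ≠ 1) (h2w : Valued.v (2 : w.1.adicCompletion L) = 1)
    (hΦsh : ∀ (t : ℕ) (x : LocalRing L v),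
      Valued.v ϖ ^ (m + 1) < Valued.v (((((l ^ t : (LocalRing L v)ˣ)) : LocalRing L v) * (-(x * conjLocal L (IsCMField.complexConj L) v x) * c)) w) →
      Valued.v (((((l ^ t : (LocalRing L v)ˣ)) : LocalRing L v) * (-(x * conjLocal L (IsCMField.complexConj L) v x) * c)) w) ≤ Valued.v ϖ ^ 2 →
      ∫ s in {s : ↥(HeisRing.skewPart (conjLocal L (IsCMField.complexConj L) v)) | Valued.v ((s : LocalRing L v) w) = WithZero.exp (-1 : ℤ)},
          (fun r : LocalRing L v => if h : IsUnit r then (((χ₁ h.unit)⁻¹ : ℂˣ) : ℂ) else 0)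
            ((((l ^ t : (LocalRing L v)ˣ)) : LocalRing L v) * (-(x * conjLocal L (IsCMField.complexConj L) v x) * c) - (s : LocalRing L v)) ∂μY = 0) :
    ∀ (j : ℕ) (x : LocalRing L v), WithZero.exp ((j : ℤ) - ((m + 1 : ℕ) : ℤ) + 1) < Valued.v (x w) * Valued.v (x w) →
      ∫ y in {y : ↥(HeisRing.skewPart (conjLocal L (IsCMField.complexConj L) v)) |
          Valued.v ((-(x * conjLocal L (IsCMField.complexConj L) v x) * c + (y : LocalRing L v)) w) = WithZero.exp (j : ℤ)},
        (fun z : LocalRing L v =>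
          if h : IsUnit z then
            ((((χ₁ (Units.map ((conjLocal L (IsCMField.complexConj L) v) : LocalRing L v →* LocalRing L v) h.unit))⁻¹ : ℂˣ) : ℂ) *
              ((((unitModulusChar (LocalRing L v) h.unit)⁻¹ : ℝ≥0) : ℝ) : ℂ))
          else 0) (-(x * conjLocal L (IsCMField.complexConj L) v x) * c + (y : LocalRing L v)) ∂μY = 0 := by
  intro j x hx
  by_cases hj : Even j
  · rw [(natCast_eq_two_mul_div_two j).1 hj]
    exact fibreRow_even L v w hw μY he h2w χ₁ h₁ hfixP hϖ hm u₁ hu₁ hχu₁ hcσ (j / 2) x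
  · have hj' := (natCast_eq_two_mul_div_two j).2 hj
    rw [hj']
    rw [hj'] at hx
    exact fibreRow_odd_lo L v w hw μY χ₁ l hlσ hlv hlm hcσ hcw hϖ m he h2w hΦsh (j / 2) x hx
end BRows
end Summit.HodgeConjecture.HodgeConjecture.R90.S1.BposRamFibreRows
end
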